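import Summits.AnomalousDissipation.AnomalousDissipation.Theorems.SolenoidalFractalHomogenisationLagrangianStepFrameTestLipschitz
import Summits.AnomalousDissipation.AnomalousDissipation.Theorems.SolenoidalFractalHomogenisationLagrangianStepFrameContinuity
import Summits.AnomalousDissipation.AnomalousDissipation.Theorems.SolenoidalFractalHomogenisationLagrangianStepFrameMeasure
import Literature.Analysis.FunctionSpaces.TorusSpaceTimeFields
import Mathlib.Topology.Maps.Proper.CompactlyGenerated
import Literature.Analysis.FluidPDE.CylinderPairings
import HarnessLib

/-!
# K1L_D (stmt-AnomalousDissipation-27980), `stub_Z7_alphaBeta` α-provider, (T1) sub-target (C5) of memos L15/L16: KINEMATICS of the Eulerian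
# field read off a frame solution (helper; `--supports … --as helper`; lead-k1l-onelevel-p1 g5)

Piece `[r₀, t]`, `r₀ = jR`, cell clock `a`, base `σ₁`; the frame solution `w τ y` (label `y` = position at the reset `r₀`) is read as the
Eulerian field `u τ x := w τ (X m r₀ (t′ τ) x)`, `t′ τ = r₀ + (σ₁+τ)/a` (backward map: current position ↦ label).  This file supplies the
kinematic fields of the Eulerian weak class for `u`: §1 the backward maps `(t″, x) ↦ X m s t″ x` are JOINTLY continuous (the forward family
`(t″,y) ↦ (t″, X m t″ s y)` is a continuous PROPER bijection of `ℝ × 𝕋³`, hence closed, hence a homeomorphism) and the space–time shear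
`(τ, x) ↦ (τ, X m s (θ τ) x)` preserves `(vol|S) × vol` (`MeasurePreserving.skew_product`); §2 measurability of `stLift u`, the `L^∞L²`
bound (volume preservation of the slices), the `|B||u| ∈ L¹` bound for a bounded continuous carrier, and the a.e. weak solenoidality of `u`
from the distorted constraint of `w` through the hypothesis-free (L1) `isWeaklyDivFree_distort_frameRead_iff'`.
NOT a proof of the stub, of the crux, or of AD; rung F-D1.A0.
-/

set_option linter.dupNamespace false  -- the summit-side namespace `Summit.AnomalousDissipation.AnomalousDissipation.…` repeats a component by design (D-0017)

noncomputable section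

namespace Summit.AnomalousDissipation.AnomalousDissipation.Theorems.SolenoidalFractalHomogenisation.LagrangianStep.FrameConj

open Set Function Filter MeasureTheory Topology
open scoped NNReal ENNReal
open Literature.Analysis Literature.Analysis.FunctionSpaces Literature.Analysis.FunctionSpaces.Torus
open Literature.Analysis.FluidPDE Literature.Analysis.FluidPDE.LatticeShear
open Literature.Analysis.FluidPDE.LatticeShear (LagrangianLatticeCarrier)

variable {k : ℕ}

/-! ## §1 Joint continuity of the backward maps and the measure-preserving space–time shear -/

/-- **The backward flow maps are jointly continuous**: `(t″, x) ↦ X m s t″ x` is continuous on `ℝ × 𝕋³`.  The forward family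
`H (t″, y) = (t″, X m t″ s y)` is a continuous bijection with inverse `K (t″, x) = (t″, X m s t″ x)` (group law); `H` is proper (the preimage
of a compact set lies in `(fst '' K′) × 𝕋³`), hence closed, so `K` pulls closed sets back to closed sets. -/
theorem continuous_X_uncurry_snd (E : LagrangianLatticeCarrier k) (hR : E.LevelRegular) (m : ℕ) (s : ℝ) :
    Continuous (fun p : ℝ × UnitAddTorus (Fin 3) => E.X m s p.1 p.2) := by
  set H : ℝ × UnitAddTorus (Fin 3) → ℝ × UnitAddTorus (Fin 3) := fun p => (p.1, E.X m p.1 s p.2) with hH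
  set K : ℝ × UnitAddTorus (Fin 3) → ℝ × UnitAddTorus (Fin 3) := fun p => (p.1, E.X m s p.1 p.2) with hK
  have hHc : Continuous H := continuous_fst.prodMk (continuous_X_uncurry E hR m s)
  have hHK : ∀ p, H (K p) = p := fun p => by
    have h := congrFun (hR.X_comp_X m p.1 s p.1) p.2
    rw [Function.comp_apply, hR.X_self m p.1] at h
    simp only [hH, hK, h, id_eq, Prod.mk.eta]
  have hKH : ∀ p, K (H p) = p := fun p => by
    have h := congrFun (hR.X_comp_X m s p.1 s) p.2
    rw [Function.comp_apply, hR.X_self m s] at h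
    simp only [hH, hK, h, id_eq, Prod.mk.eta]
  -- `H` is proper, hence closed
  have hHproper : IsProperMap H := by
    refine isProperMap_iff_isCompact_preimage.2 ⟨hHc, fun K' hK' => ?_⟩
    have hsub : H ⁻¹' K' ⊆ (Prod.fst '' K') ×ˢ (univ : Set (UnitAddTorus (Fin 3))) := fun p hp =>
      mk_mem_prod ⟨H p, hp, rfl⟩ (mem_univ _)
    exact ((hK'.image continuous_fst).prod isCompact_univ).of_isClosed_subset (hK'.isClosed.preimage hHc) hsub
  have hHclosed : IsClosedMap H := hHproper.isClosedMap
  -- `K` is continuous: preimages of closed sets are images under `H`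
  have hKc : Continuous K := by
    rw [continuous_iff_isClosed]
    intro C hC
    have e : K ⁻¹' C = H '' C := by
      ext p
      refine ⟨fun hp => ⟨K p, hp, hHK p⟩, ?_⟩
      rintro ⟨q, hq, rfl⟩
      show K (H q) ∈ C
      rw [hKH q]; exact hq
    rw [e]; exact hHclosed C hC
  exact continuous_snd.comp hKc

/-- **The space–time shear by backward maps preserves `(vol|S) × vol`**: `(τ, x) ↦ (τ, X m s (θ τ) x)` for a continuous clock `θ`
(`MeasurePreserving.skew_product`; each slice map preserves the volume of the torus). -/
theorem measurePreserving_shear (E : LagrangianLatticeCarrier k) (hR : E.LevelRegular) (m : ℕ) (s : ℝ) {θ : ℝ → ℝ}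
    (hθ : Continuous θ) (S : Set ℝ) :
    MeasurePreserving (fun p : ℝ × UnitAddTorus (Fin 3) => (p.1, E.X m s (θ p.1) p.2))
      ((volume.restrict S).prod volume) ((volume.restrict S).prod volume) := by
  have hgm : Measurable (uncurry fun (τ : ℝ) (x : UnitAddTorus (Fin 3)) => E.X m s (θ τ) x) :=
    ((continuous_X_uncurry_snd E hR m s).comp ((hθ.comp continuous_fst).prodMk continuous_snd)).measurable
  have h := (MeasurePreserving.id (volume.restrict S)).skew_product (g := fun τ x => E.X m s (θ τ) x) hgm
    (Filter.Eventually.of_forall fun τ => (hR.measurePreserving_X m s (θ τ)).map_eq)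
  exact h

/-! ## §2 Kinematic fields of the Eulerian reading `u τ x = w τ (X m s (θ τ) x)` -/

/-- **Measurability of the Eulerian reading**: if `stLift w` is a.e. strongly measurable on `S × ℝ³` then so is the lift of
`u τ x := w τ (X m s (θ τ) x)`. -/
theorem aestronglyMeasurable_stLift_read {F : Type*} [TopologicalSpace F] [TopologicalSpace.PseudoMetrizableSpace F]
    (E : LagrangianLatticeCarrier k) (hR : E.LevelRegular)
    (m : ℕ) (s : ℝ) {θ : ℝ → ℝ} (hθ : Continuous θ) {S : Set ℝ} {w : ℝ → UnitAddTorus (Fin 3) → F}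
    (hw : AEStronglyMeasurable (uncurry w) ((volume.restrict S).prod volume)) :
    AEStronglyMeasurable (stLift fun τ x => w τ (E.X m s (θ τ) x)) (volume.restrict (S ×ˢ (univ : Set (EuclideanSpace ℝ (Fin 3))))) := by
  refine aestronglyMeasurable_stLift_of_uncurry ?_
  have e : (uncurry fun τ x => w τ (E.X m s (θ τ) x)) = uncurry w ∘ fun p : ℝ × UnitAddTorus (Fin 3) => (p.1, E.X m s (θ p.1) p.2) := by
    funext p; rfl
  rw [e]
  exact hw.comp_measurePreserving (measurePreserving_shear E hR m s hθ S)

/-- **The `L^∞L²` bound transfers** (volume preservation of every slice map). -/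
theorem ae_lintegral_sq_read_le (E : LagrangianLatticeCarrier k) (hR : E.LevelRegular) (m : ℕ) (s : ℝ) (θ : ℝ → ℝ) {S : Set ℝ}
    {w : ℝ → UnitAddTorus (Fin 3) → EuclideanSpace ℝ (Fin 3)} {C : ℝ≥0}
    (hmeas : ∀ᵐ τ ∂(volume.restrict S), AEStronglyMeasurable (w τ) volume)
    (hC : ∀ᵐ τ ∂(volume.restrict S), ∫⁻ y, ‖w τ y‖ₑ ^ 2 ≤ C) :
    ∀ᵐ τ ∂(volume.restrict S), ∫⁻ x, ‖w τ (E.X m s (θ τ) x)‖ₑ ^ 2 ≤ C := by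
  filter_upwards [hmeas, hC] with τ hm hc
  rw [lintegral_comp_X E hR m s (θ τ) (f := fun y => ‖w τ y‖ₑ ^ 2) (hm.enorm.pow_const 2)]
  exact hc

/-- **`|B| |u| ∈ L¹` for a bounded carrier and an `L^∞L²` field** on a finite time interval. -/
theorem lintegral_mul_lt_top_of_bound {B u : ℝ → UnitAddTorus (Fin 3) → EuclideanSpace ℝ (Fin 3)} {T CB : ℝ} {C : ℝ≥0}
    (hB : ∀ τ ∈ Icc 0 T, ∀ x, ‖B τ x‖ ≤ CB) (hu : ∀ᵐ τ ∂(volume.restrict (Ioo 0 T)), ∫⁻ x, ‖u τ x‖ₑ ^ 2 ≤ C) :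
    ∫⁻ τ in Ioo 0 T, ∫⁻ x, ‖B τ x‖ₑ * ‖u τ x‖ₑ < ∞ := by
  have hpt : ∀ᵐ τ ∂(volume.restrict (Ioo 0 T)), ∫⁻ x, ‖B τ x‖ₑ * ‖u τ x‖ₑ ≤ ENNReal.ofReal CB * (1 + C) := by
    filter_upwards [hu, ae_restrict_mem measurableSet_Ioo] with τ hτ hτI
    calc ∫⁻ x, ‖B τ x‖ₑ * ‖u τ x‖ₑ ≤ ∫⁻ x, ENNReal.ofReal CB * (1 + ‖u τ x‖ₑ ^ 2) := by
          refine lintegral_mono fun x => mul_le_mul' ?_ (ENNReal.le_one_add_sq _)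
          rw [← ofReal_norm]
          exact ENNReal.ofReal_le_ofReal (hB τ (Ioo_subset_Icc_self hτI) x)
      _ = ENNReal.ofReal CB * (1 + ∫⁻ x, ‖u τ x‖ₑ ^ 2) := by
          rw [lintegral_const_mul' _ _ ENNReal.ofReal_ne_top, lintegral_add_left' aemeasurable_const, lintegral_const,
            measure_univ, mul_one]
      _ ≤ ENNReal.ofReal CB * (1 + C) := by gcongr
  calc ∫⁻ τ in Ioo 0 T, ∫⁻ x, ‖B τ x‖ₑ * ‖u τ x‖ₑ ≤ ∫⁻ _τ in Ioo 0 T, ENNReal.ofReal CB * (1 + C) := lintegral_mono_ae hpt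
    _ < ∞ := by
        rw [lintegral_const, Measure.restrict_apply MeasurableSet.univ, univ_inter]
        exact ENNReal.mul_lt_top (ENNReal.mul_lt_top ENNReal.ofReal_lt_top (by simp)) (measure_Ioo_lt_top)

/-- **The carrier's `L¹L²` bound** for a bounded carrier on a finite time interval. -/
theorem lintegral_carrier_lt_top_of_bound {B : ℝ → UnitAddTorus (Fin 3) → EuclideanSpace ℝ (Fin 3)} {T CB : ℝ}
    (hB : ∀ τ ∈ Icc 0 T, ∀ x, ‖B τ x‖ ≤ CB) :
    ∫⁻ τ in Ioo 0 T, (∫⁻ x, ‖B τ x‖ₑ ^ 2) ^ (1 / 2 : ℝ) < ∞ := by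
  have hpt : ∀ᵐ τ ∂(volume.restrict (Ioo 0 T)), (∫⁻ x, ‖B τ x‖ₑ ^ 2) ^ (1 / 2 : ℝ) ≤ (ENNReal.ofReal CB ^ 2) ^ (1 / 2 : ℝ) := by
    filter_upwards [ae_restrict_mem measurableSet_Ioo] with τ hτI
    gcongr
    calc ∫⁻ x, ‖B τ x‖ₑ ^ 2 ≤ ∫⁻ _x : UnitAddTorus (Fin 3), ENNReal.ofReal CB ^ 2 := by
          refine lintegral_mono fun x => ?_
          gcongr
          rw [← ofReal_norm]
          exact ENNReal.ofReal_le_ofReal (hB τ (Ioo_subset_Icc_self hτI) x)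
      _ = ENNReal.ofReal CB ^ 2 := by rw [lintegral_const, measure_univ, mul_one]
  calc ∫⁻ τ in Ioo 0 T, (∫⁻ x, ‖B τ x‖ₑ ^ 2) ^ (1 / 2 : ℝ)
      ≤ ∫⁻ _τ in Ioo 0 T, (ENNReal.ofReal CB ^ 2) ^ (1 / 2 : ℝ) := lintegral_mono_ae hpt
    _ < ∞ := by
        rw [lintegral_const, Measure.restrict_apply MeasurableSet.univ, univ_inter]
        refine ENNReal.mul_lt_top ?_ measure_Ioo_lt_top
        exact ENNReal.rpow_lt_top_of_nonneg (by norm_num) (ENNReal.pow_ne_top ENNReal.ofReal_ne_top)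

/-- **A.e. weak solenoidality of the Eulerian reading from the distorted constraint of the frame solution** (through the hypothesis-free
(L1)): if `w τ ∈ L²` and `∇·(frameG(t′)·w τ) = 0` weakly with `t′ = s + σ/a`, then `x ↦ w τ (X m s t′ x)` is weakly divergence free. -/
theorem isWeaklyDivFree_read (E : LagrangianLatticeCarrier k) (hR : E.LevelRegular) (m : ℕ) (s σ : ℝ)
    {v : UnitAddTorus (Fin 3) → EuclideanSpace ℝ (Fin 3)} (hv : MemLp v 2 volume)
    (hdiv : Torus.IsWeaklyDivFree (FluidPDE.Torus.distort (frameG E m (s + σ / E.a (m + 1)) s) v)) :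
    Torus.IsWeaklyDivFree (fun x => v (E.X m s (s + σ / E.a (m + 1)) x)) := by
  -- the Eulerian reading as an `L²` class
  have hu2 : MemLp (fun x => v (E.X m s (s + σ / E.a (m + 1)) x)) 2 volume := hv.comp_measurePreserving (hR.measurePreserving_X m s _)
  set U : V2 := hu2.toLp _ with hU
  have hXX : ∀ y, E.X m s (s + σ / E.a (m + 1)) (E.X m (s + σ / E.a (m + 1)) s y) = y := fun y => by
    have h := congrFun (hR.X_comp_X m s (s + σ / E.a (m + 1)) s) y
    rw [Function.comp_apply, hR.X_self m s] at h
    exact h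
  -- its frame reading is `v` a.e.
  have hread : (⇑(frameRead E hR m s σ U) : VF) =ᵐ[volume] v := by
    have h1 := frameRead_coeFn E hR m s σ U
    have h2 : (fun y => (U : VF) (E.X m (s + σ / E.a (m + 1)) s y)) =ᵐ[volume]
        fun y => (fun x => v (E.X m s (s + σ / E.a (m + 1)) x)) (E.X m (s + σ / E.a (m + 1)) s y) :=
      (hR.measurePreserving_X m _ s).quasiMeasurePreserving.ae_eq_comp (MemLp.coeFn_toLp hu2)
    refine (h1.trans h2).trans (Filter.Eventually.of_forall fun y => ?_)
    simp only [hXX]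
  have hdiv' : Torus.IsWeaklyDivFree (FluidPDE.Torus.distort (frameG E m (s + σ / E.a (m + 1)) s) (⇑(frameRead E hR m s σ U) : VF)) := by
    refine hdiv.congr_ae ?_
    filter_upwards [hread] with y hy
    simp only [FluidPDE.Torus.distort, hy]
  have hUdiv := (isWeaklyDivFree_distort_frameRead_iff' E hR m s σ U).1 hdiv'
  exact hUdiv.congr_ae (MemLp.coeFn_toLp hu2)

end Summit.AnomalousDissipation.AnomalousDissipation.Theorems.SolenoidalFractalHomogenisation.LagrangianStep.FrameConj

end
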